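import Literature.Analysis.FluidPDE.AdditiveNoiseFlowDerivative
import Literature.Analysis.FunctionSpaces.FlatTorusProofs
import Mathlib.Algebra.Module.ZLattice.Basic
import Mathlib.MeasureTheory.Group.FundamentalDomain
import Mathlib.MeasureTheory.Function.Jacobian
import Mathlib.MeasureTheory.Constructions.Polish.Basic
import HarnessLib

/-!
# Measure preservation of the noisy Lagrangian flow maps on `T^d` (Liouville, pathwise form of
the incompressibility used in JS24 Lemma 2.8)

Topic `Literature/Analysis/FluidPDE` (theorems only). Johansson–Sorella, arXiv:2409.03599,
proof of Lemma 2.8 (p. 9): "the last identity [`∫∫ |θ_in(X_{T,0}(x,ω))|² dx dP = ∫ |θ_in|²`]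
follows from the fact that the backward stochastic flow is measure preserving" (the drift being
divergence free and the noise additive). Pathwise (`AdditiveNoiseCharacteristics`,
`AdditiveNoiseFlowDerivative`) the time-`s` map of the noisy flow is `x ↦ φ s x` on `T^d`, the
descent of the `ℤ^d`-equivariant bijection `X = Y(·) s + c(s)` of `ℝ^d`, which is everywhere
differentiable with Jacobian determinant `1`. This file proves:

* `Torus.measurePreserving_of_equivariant_det_one` — **abstract transfer**: a `ℤ^d`-equivariant
  bijection `X` of `ℝ^d`, differentiable everywhere with `det DX ≡ 1`, descends to a
  MEASURE-PRESERVING map of `T^d` (any measurable `φ` with `φ ∘ proj = proj ∘ X`). Proof: by the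
  area formula (Mathlib `lintegral_abs_det_fderiv_eq_addHaar_image`) `X` preserves Lebesgue measure
  of sets; the unit cube `Q` and its image `X '' Q` are both fundamental domains of the lattice
  `ℤ^d = span_ℤ(eᵢ)` (Mathlib `ZSpan.isAddFundamentalDomain`, `IsAddFundamentalDomain.image_of_equiv`),
  so every lattice-invariant set `P = proj⁻¹ B` has `λ(P ∩ Q) = λ(P ∩ X '' Q)`
  (`IsAddFundamentalDomain.measure_set_eq`); and `vol_T = proj_* (λ⌊Q)`
  (`Torus.measurePreserving_proj_unitCube_holds`).
* `Torus.measurePreserving_noisyFlow` — for a divergence-free drift jointly smooth on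
  `[a,b] × T^d`, every solution family of the pathwise equation of Def. 2.6 with its torus maps
  `φ s` (as produced by `Torus.exists_noisyFlow`) has `φ s` measure preserving for all `s ∈ [a,b]`.
* `Torus.exists_measurePreserving_noisyFlow` — the packaged existence statement.

## References

* C. J. P. Johansson, M. Sorella, arXiv:2409.03599v2 (2024), Def. 2.6 and proof of Lemma 2.8,
  p. 9. [`JohanssonSorella2024`]
* V. I. Arnold, *Mathematical Methods of Classical Mechanics* (1989), §16 (Liouville's theorem).
  [folklore]
-/

noncomputable section

open MeasureTheory Set Filter Metric Function
open scoped NNReal ENNReal ContDiff Topology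

namespace Literature.Analysis.FluidPDE

namespace Torus

open FunctionSpaces FunctionSpaces.Torus Literature.Analysis.ODE

variable {d : Type*} [Fintype d]

/-! ## Lattice vectors and the `ℤ`-span of the standard basis -/

section Lattice

variable [DecidableEq d]

/-- Elements of the `ℤ`-span of the standard basis of `ℝ^d` are the lattice vectors
`latticeVec k`, `k ∈ ℤ^d`. [folklore] -/
theorem exists_latticeVec_of_mem_span {g : EuclideanSpace ℝ d}
    (hg : g ∈ Submodule.span ℤ (Set.range (EuclideanSpace.basisFun d ℝ).toBasis)) :
    ∃ k : d → ℤ, g = latticeVec k := by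
  rw [Module.Basis.mem_span_iff_repr_mem ℤ (EuclideanSpace.basisFun d ℝ).toBasis g] at hg
  choose k hk using hg
  refine ⟨k, ?_⟩
  ext i
  rw [latticeVec_apply]
  have h := hk i
  simp only [OrthonormalBasis.coe_toBasis_repr_apply, EuclideanSpace.basisFun_repr,
    eq_intCast] at h
  exact h.symm

omit [DecidableEq d] in
/-- The `ZSpan` fundamental domain of the standard basis is the unit cube `[0,1)^d`. [folklore] -/
theorem fundamentalDomain_basisFun_eq_unitCube :
    ZSpan.fundamentalDomain (EuclideanSpace.basisFun d ℝ).toBasis = unitCube d := by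
  ext y
  simp [ZSpan.mem_fundamentalDomain, mem_unitCube]

end Lattice

/-! ## The abstract transfer: equivariant volume-preserving bijections descend to `T^d` -/

section Transfer

variable [DecidableEq d]

omit [DecidableEq d] in
/-- **An everywhere differentiable bijection of `ℝ^d` with Jacobian determinant `1` preserves the
Lebesgue measure of measurable sets** (area formula,
Mathlib `lintegral_abs_det_fderiv_eq_addHaar_image`). [folklore] -/
theorem volume_image_eq_of_det_one {X : EuclideanSpace ℝ d → EuclideanSpace ℝ d}
    {X' : EuclideanSpace ℝ d → EuclideanSpace ℝ d →L[ℝ] EuclideanSpace ℝ d}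
    (hX : ∀ y, HasFDerivAt X (X' y) y) (hdet : ∀ y, (X' y).det = 1) (hinj : Injective X)
    {S : Set (EuclideanSpace ℝ d)} (hS : MeasurableSet S) : volume (X '' S) = volume S := by
  have h := lintegral_abs_det_fderiv_eq_addHaar_image volume hS
    (fun y _ => (hX y).hasFDerivWithinAt) hinj.injOn
  simp only [hdet, abs_one, ENNReal.ofReal_one, setLIntegral_one] at h
  exact h.symm

/-- **Equivariant volume-preserving bijections of `ℝ^d` descend to measure-preserving maps of
`T^d`.** Let `X` be a bijection of `ℝ^d`, differentiable everywhere with `det DX ≡ 1`, commuting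
with the lattice translations, and let `φ : T^d → T^d` be measurable with `φ (proj y) = proj (X y)`.
Then `φ` preserves the Haar probability measure of `T^d`: for a Borel `B ⊆ T^d`, with
`P = proj⁻¹ B` (lattice invariant) and `Q = [0,1)^d`,
`vol_T(φ⁻¹ B) = λ(X⁻¹P ∩ Q) = λ(X(X⁻¹P ∩ Q)) = λ(P ∩ X(Q)) = λ(P ∩ Q) = vol_T(B)`, the fourth
equality because `Q` and `X(Q)` are fundamental domains of `ℤ^d`. [folklore] -/
theorem measurePreserving_of_equivariant_det_one {X : EuclideanSpace ℝ d → EuclideanSpace ℝ d}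
    {X' : EuclideanSpace ℝ d → EuclideanSpace ℝ d →L[ℝ] EuclideanSpace ℝ d}
    (hX : ∀ y, HasFDerivAt X (X' y) y) (hdet : ∀ y, (X' y).det = 1) (hbij : Bijective X)
    (heq : ∀ y (k : d → ℤ), X (y + latticeVec k) = X y + latticeVec k)
    {φ : UnitAddTorus d → UnitAddTorus d} (hφm : Measurable φ)
    (hφ : ∀ y, φ (proj y) = proj (X y)) : MeasurePreserving φ volume volume := by
  haveI : VAddInvariantMeasure (Submodule.span ℤ (Set.range (EuclideanSpace.basisFun d ℝ).toBasis))
      (EuclideanSpace ℝ d) (volume : Measure (EuclideanSpace ℝ d)) :=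
    inferInstanceAs <| VAddInvariantMeasure
      (Submodule.span ℤ (Set.range (EuclideanSpace.basisFun d ℝ).toBasis)).toAddSubgroup
      (EuclideanSpace ℝ d) (volume : Measure (EuclideanSpace ℝ d))
  have hvadd : ∀ (g : Submodule.span ℤ (Set.range (EuclideanSpace.basisFun d ℝ).toBasis))
      (x : EuclideanSpace ℝ d), g +ᵥ x = (g : EuclideanSpace ℝ d) + x := fun g x => rfl
  -- `X` preserves the Lebesgue measure of sets and is a measurable embedding
  have hXc : Continuous X := continuous_iff_continuousAt.2 fun y => (hX y).continuousAt
  have himage : ∀ S, MeasurableSet S → volume (X '' S) = volume S := fun S hS =>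
    volume_image_eq_of_det_one hX hdet hbij.1 hS
  have hemb : MeasurableEmbedding X := hXc.measurableEmbedding hbij.1
  -- the inverse, as an equivalence, is quasi measure preserving
  set e : EuclideanSpace ℝ d ≃ EuclideanSpace ℝ d := Equiv.ofBijective X hbij with he
  have hpre : ∀ S : Set (EuclideanSpace ℝ d), e.symm ⁻¹' S = X '' S := fun S => by
    ext z
    constructor
    · intro hz
      exact ⟨e.symm z, hz, e.apply_symm_apply z⟩
    · rintro ⟨y, hy, rfl⟩
      show e.symm (e y) ∈ S
      rwa [e.symm_apply_apply]
  have hsymm_meas : Measurable e.symm := fun S hS => by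
    rw [hpre]
    exact hemb.measurableSet_image.2 hS
  have hmap : Measure.map e.symm volume = (volume : Measure (EuclideanSpace ℝ d)) :=
    Measure.ext fun S hS => by rw [Measure.map_apply hsymm_meas hS, hpre, himage S hS]
  have hqmp : Measure.QuasiMeasurePreserving e.symm volume volume := ⟨hsymm_meas, by rw [hmap]⟩
  -- the unit cube and its image are fundamental domains of the lattice
  have hQ : IsAddFundamentalDomain (Submodule.span ℤ (Set.range (EuclideanSpace.basisFun d ℝ).toBasis))
      (unitCube d) (volume : Measure (EuclideanSpace ℝ d)) := by
    have h := ZSpan.isAddFundamentalDomain (EuclideanSpace.basisFun d ℝ).toBasis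
      (volume : Measure (EuclideanSpace ℝ d))
    rwa [fundamentalDomain_basisFun_eq_unitCube] at h
  have hQ' : IsAddFundamentalDomain (Submodule.span ℤ (Set.range (EuclideanSpace.basisFun d ℝ).toBasis))
      (X '' unitCube d) (volume : Measure (EuclideanSpace ℝ d)) := by
    refine hQ.image_of_equiv e hqmp (Equiv.refl _) fun g y => ?_
    obtain ⟨k, hk⟩ := exists_latticeVec_of_mem_span g.2
    show X ((g : EuclideanSpace ℝ d) + y) = (g : EuclideanSpace ℝ d) + X y
    rw [hk, add_comm, heq, add_comm]
  -- the computation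
  have hmp := measurePreserving_proj_unitCube_holds (d := d)
  refine ⟨hφm, Measure.ext fun B hB => ?_⟩
  rw [Measure.map_apply hφm hB]
  have hP : MeasurableSet ((proj : EuclideanSpace ℝ d → UnitAddTorus d) ⁻¹' B) := measurable_proj hB
  have hinv : ∀ g : Submodule.span ℤ (Set.range (EuclideanSpace.basisFun d ℝ).toBasis),
      (fun x => g +ᵥ x) ⁻¹' ((proj : EuclideanSpace ℝ d → UnitAddTorus d) ⁻¹' B) = proj ⁻¹' B := by
    intro g
    obtain ⟨k, hk⟩ := exists_latticeVec_of_mem_span g.2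
    ext y
    simp only [mem_preimage, hvadd, hk]
    rw [add_comm, proj_add_latticeVec]
  have hset := hQ.measure_set_eq hQ' hP hinv
  have h1 : volume (φ ⁻¹' B) =
      volume (X ⁻¹' ((proj : EuclideanSpace ℝ d → UnitAddTorus d) ⁻¹' B) ∩ unitCube d) := by
    rw [← hmp.measure_preimage (hφm hB).nullMeasurableSet,
      Measure.restrict_apply (measurable_proj (hφm hB))]
    congr 1
    ext y
    simp only [mem_inter_iff, mem_preimage, hφ]
  have h2 : volume B = volume ((proj : EuclideanSpace ℝ d → UnitAddTorus d) ⁻¹' B ∩ unitCube d) := by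
    rw [← hmp.measure_preimage hB.nullMeasurableSet, Measure.restrict_apply hP]
  rw [h1, h2, hset, ← image_preimage_inter,
    himage _ ((hemb.measurable hP).inter measurableSet_unitCube)]

end Transfer

/-! ## Application: the noisy Lagrangian flow of a divergence-free drift -/

section NoisyFlow

variable [DecidableEq d] {a b t₀ : ℝ} {u : ℝ → UnitAddTorus d → EuclideanSpace ℝ d}
  {c : ℝ → EuclideanSpace ℝ d}

/-- **Measure preservation of the pathwise noisy flow maps** (the incompressibility used in JS24
Lemma 2.8, pathwise). For a divergence-free drift `u` jointly smooth on `[a,b] × T^d`, `a < b`, a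
continuous shift `c`, a family `Y y` of solutions of `Y' = u(s, Y + c(s))` within `[a,b]` with
`Y y t₀ = y`, `ℤ^d`-equivariant, and measurable torus maps `φ s` with
`φ s (proj y) = proj (Y y s + c s)`, every `φ s`, `s ∈ [a,b]`, preserves the volume of `T^d`
(`measurePreserving_of_equivariant_det_one` with `exists_hasFDerivAt_noisyFlow`,
`det_linearization_eq_one`, `noisyFlow_injective`, `noisyFlow_surjective`).
[cite: JohanssonSorella2024, Def. 2.6 and proof of Lemma 2.8, p. 9] -/
theorem measurePreserving_noisyFlow (hab : a < b) (hu : IsSmoothSpaceTimeOn (Icc a b) u)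
    (hdiv : ∀ s ∈ Icc a b, IsDivFree (u s)) (hc : ContinuousOn c (Icc a b)) (ht₀ : t₀ ∈ Icc a b)
    {Y : EuclideanSpace ℝ d → ℝ → EuclideanSpace ℝ d} (hY0 : ∀ y, Y y t₀ = y)
    (hY : ∀ y, ∀ s ∈ Icc a b, HasDerivWithinAt (Y y) (lift (u s) (Y y s + c s)) (Icc a b) s)
    (hEq : ∀ y (k : d → ℤ), ∀ s ∈ Icc a b, Y (y + latticeVec k) s = Y y s + latticeVec k)
    {φ : ℝ → UnitAddTorus d → UnitAddTorus d}
    (hφ : ∀ s ∈ Icc a b, ∀ y, φ s (proj y) = proj (Y y s + c s))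
    (hφm : ∀ s ∈ Icc a b, Measurable (φ s)) {s : ℝ} (hs : s ∈ Icc a b) :
    MeasurePreserving (φ s) volume volume := by
  choose J hJ0 hJ hJd using fun y => exists_hasFDerivAt_noisyFlow hab hu hc ht₀ hY0 hY y
  refine measurePreserving_of_equivariant_det_one (X := fun y => Y y s + c s)
    (X' := fun y => J y s) (fun y => (hJd y s hs).add_const (c s))
    (fun y => det_linearization_eq_one hdiv hu ht₀ (hJ0 y) (hJ y) hs)
    ⟨fun y₁ y₂ h => noisyFlow_injective hab hu ht₀ hY0 hY hs (add_right_cancel h), fun z => ?_⟩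
    (fun y k => by simp only [hEq y k s hs, add_right_comm]) (hφm s hs) (hφ s hs)
  obtain ⟨y, hy⟩ := noisyFlow_surjective hab hu hc ht₀ hY0 hY hs (z - c s)
  have hy' : Y y s = z - c s := hy
  exact ⟨y, by simp only [hy', sub_add_cancel]⟩

/-- **The pathwise noisy Lagrangian flow of a divergence-free drift is measure preserving**
(JS24 Def. 2.6 with the incompressibility used in Lemma 2.8, for every continuous noise path):
the family of `Torus.exists_noisyFlow`, with in addition `φ s` measure preserving on `T^d` for
every `s ∈ [a,b]`. [cite: JohanssonSorella2024, Def. 2.6 and proof of Lemma 2.8, p. 9] -/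
theorem exists_measurePreserving_noisyFlow (hab : a < b) (hu : IsSmoothSpaceTimeOn (Icc a b) u)
    (hdiv : ∀ s ∈ Icc a b, IsDivFree (u s)) {w : ℝ → EuclideanSpace ℝ d}
    (hw : ContinuousOn w (Icc a b)) (ht₀ : t₀ ∈ Icc a b) :
    ∃ (Y : EuclideanSpace ℝ d → ℝ → EuclideanSpace ℝ d) (φ : ℝ → UnitAddTorus d → UnitAddTorus d),
      (∀ y, Y y t₀ = y) ∧
      (∀ y, ∀ s ∈ Icc a b,
        HasDerivWithinAt (Y y) (lift (u s) (Y y s + (w s - w t₀))) (Icc a b) s) ∧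
      (∃ K : ℝ≥0, ∀ s ∈ Icc a b, ∀ y₁ y₂,
        dist (Y y₁ s) (Y y₂ s) ≤ dist y₁ y₂ * Real.exp (K * |s - t₀|)) ∧
      (∀ y (k : d → ℤ), ∀ s ∈ Icc a b, Y (y + latticeVec k) s = Y y s + latticeVec k) ∧
      (∀ y, ∀ s ∈ Icc a b, Y y s + (w s - w t₀) =
        y + (∫ r in t₀..s, lift (u r) (Y y r + (w r - w t₀))) + (w s - w t₀)) ∧
      (∀ s ∈ Icc a b, ∀ y, φ s (proj y) = proj (Y y s + (w s - w t₀))) ∧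
      (∀ s ∈ Icc a b, Continuous (φ s)) ∧
      (∀ s ∈ Icc a b, MeasurePreserving (φ s) volume volume) := by
  obtain ⟨Y, φ, hY0, hY, hK, hEq, hInt, hφ, hφc⟩ := exists_noisyFlow hab hu hw ht₀
  refine ⟨Y, φ, hY0, hY, hK, hEq, hInt, hφ, hφc, fun s hs => ?_⟩
  exact measurePreserving_noisyFlow (c := fun s => w s - w t₀) hab hu hdiv
    (hw.sub continuousOn_const) ht₀ hY0 hY hEq hφ (fun s hs => (hφc s hs).measurable) hs

end NoisyFlow

end Torus

end Literature.Analysis.FluidPDE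

end
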